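import Mathlib.Analysis.Convex.Topology
import Literature.Probability.RandomPlanarGeometry.BoundaryCycle
import Literature.Probability.RandomPlanarGeometry.PolygonWinding
import Literature.Probability.RandomPlanarGeometry.USTPeanoPathGeometry
import Literature.Probability.RandomPlanarGeometry.USTPeanoSegments
import Literature.Probability.RandomPlanarGeometry.USTPeanoPeelingStep
import HarnessLib

/-!
# The domains `D ∈ 𝔇*` satisfy the peeling axioms: local analysis at `a` ([LSW04] §4.1)

For a lattice domain `D = D(α, β, a, b)` with simple boundary polygon
(`USTPeano.Domain`, [LSW04] §4.1 and §4.3) we verify the axioms `PeelData.Good` of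
`USTPeanoPeeling.lean` for its peeling data `D.peelData` (`V` = the Peano vertices in `D`):

* (X0) is part of the structure; `α`, `β` are duplicate-free because the boundary polygon is
  simple;
* (X1) `Domain.not_isDualPair` — no edge of `α` crosses an edge of `β`: the common midpoint would
  lie on two distinct half-open edges of the simple boundary polygon;
* (X2) `Domain.closed_peelData` — an unblocked Manhattan edge from `a` or from a Peano vertex of
  `D` ends in `D` or at `b`. This is where the topology of the Jordan domain `D` enters, and only
  here, through: a connected set missing `∂D` and meeting `D` lies in `D`
  (`Domain.subset_carrier_of_isPreconnected` of `USTPeanoPathGeometry.lean`), and `∂D ⊆ closure (ext D)`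
  (`JordanDomain.frontier_subset_closure_exterior`, from the Jordan curve theorem proved in the
  tree). The geometric input is LOCAL AT `a` ([LSW04] p. 971: "assume that `D` lies to the
  immediate right of the oriented segment `[α_a, β_a]`"): within distance `¼` of `a` the boundary
  polygon is the straight segment `[α_a, β_a]` (`Domain.mem_segment_of_mem_frontier`), so the open
  half-disc `H⁺` on the right of it lies in `D` (it is convex, misses `∂D` and contains the test
  point `rightTestPt a ∈ D`) and the open half-disc `H⁻` on the left misses `D` (otherwise a whole
  punctured neighbourhood of `a ∈ ∂D` would lie in `D ∪ ∂D`); the two Manhattan edges leaving `a`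
  start into `H⁺`, the two entering `a` arrive through `H⁻` (`cross_dir_stepD`, …).

Finally `Domain.good_peelData : D.peelData.Good`.
-/

noncomputable section

open Set Complex Metric

namespace Literature.Probability.RandomPlanarGeometry

namespace USTPeano

/-! ### Chains from consecutive pairs; two index computations in the boundary cycle -/

/-- A relation holding for all consecutive pairs makes the list a chain. [folklore] -/
theorem isChain_of_forall_zip_tail {X : Type*} {R : X → X → Prop} :
    ∀ {l : List X}, (∀ e ∈ l.zip l.tail, R e.1 e.2) → l.IsChain R
  | [], _ => List.IsChain.nil
  | [x], _ => List.isChain_singleton x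
  | x :: y :: l, h => by
    rw [List.isChain_cons_cons]
    refine ⟨h (x, y) (by simp), isChain_of_forall_zip_tail fun e he ↦ h e ?_⟩
    rw [zip_tail_cons_cons]
    exact List.mem_cons_of_mem _ he

/-- The vertices `1, …, |α|` of the boundary cycle are the points of `α`. [folklore] -/
theorem boundaryVerts_getElem_succ {α β : List (ℤ × ℤ)} (a b : ℤ × ℤ) {i : ℕ} (hi : i < α.length) :
    (boundaryVerts α β a b)[i + 1]'(by simp; omega) = primalPt α[i] := by
  simp only [boundaryVerts, List.getElem_cons_succ]
  rw [List.getElem_append_left (by simpa using hi)]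
  simp

/-- The vertices `|α| + 2, …, |α| + |β| + 1` of the boundary cycle are the points of `β`,
backwards: vertex `|α| + |β| + 1 - t` is `β[t]`. [folklore] -/
theorem boundaryVerts_getElem_β {α β : List (ℤ × ℤ)} (a b : ℤ × ℤ) {t : ℕ} (ht : t < β.length) :
    (boundaryVerts α β a b)[α.length + β.length + 1 - t]'(by simp; omega) = dualPt β[t] := by
  rw [getElem_congr_idx (show α.length + β.length + 1 - t = (α.length + (β.length - t)) + 1 by omega)]
  simp only [boundaryVerts, List.getElem_cons_succ]
  rw [List.getElem_append_right (by simp)]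
  simp only [List.length_map, Nat.add_sub_cancel_left]
  rw [getElem_congr_idx (show β.length - t = (β.length - t - 1) + 1 by omega), List.getElem_cons_succ,
    List.getElem_reverse]
  simp only [List.length_map, List.getElem_map]
  congr 2
  omega

/-- Vertex `1` of the boundary cycle is `α_a`. [folklore] -/
theorem boundaryVerts_one {α β : List (ℤ × ℤ)} (a b : ℤ × ℤ) (hα : α ≠ []) :
    (boundaryVerts α β a b)[1]'(by simp) = primalPt (α.head hα) := by
  rw [boundaryVerts_getElem_succ a b (List.length_pos_iff.2 hα), List.head_eq_getElem]

/-- The last vertex of the boundary cycle is `β_a`. [folklore] -/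
theorem boundaryVerts_length_sub_one {α β : List (ℤ × ℤ)} (a b : ℤ × ℤ) (hβ : β ≠ []) :
    (boundaryVerts α β a b)[(boundaryVerts α β a b).length - 1]'(by simp) = dualPt (β.head hβ) := by
  rw [getElem_congr_idx (show (boundaryVerts α β a b).length - 1 = α.length + β.length + 1 - 0 by
    simp), boundaryVerts_getElem_β a b (List.length_pos_iff.2 hβ), List.head_eq_getElem]

namespace Domain

variable (D : Domain)

/-! ### The peeling data of a domain -/

/-- **The peeling data of `D(α, β, a, b)`**: the Peano vertices in `D`, the walls `α`, `β`, and
`a`, `b`. [cite: LawlerSchrammWerner2004, §4.1] -/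
def peelData : PeelData where
  V := D.finite_peanoVerts.toFinset
  α := D.α
  β := D.β
  a := D.a
  b := D.b

/-- Components of the peeling data. [folklore] -/
@[simp] theorem peelData_a : D.peelData.a = D.a := rfl

/-- Components of the peeling data. [folklore] -/
@[simp] theorem peelData_b : D.peelData.b = D.b := rfl

/-- Components of the peeling data. [folklore] -/
@[simp] theorem peelData_α : D.peelData.α = D.α := rfl

/-- Components of the peeling data. [folklore] -/
@[simp] theorem peelData_β : D.peelData.β = D.β := rfl

/-- Membership in `V`. [folklore] -/
@[simp] theorem mem_peelData_V {p : ℤ × ℤ} : p ∈ D.peelData.V ↔ peanoPt p ∈ D.carrier := by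
  simp [peelData]

/-- `α` has no repeated vertex (the boundary polygon is simple). [folklore] -/
theorem nodup_α : D.α.Nodup := by
  have h := D.simple.nodup
  rw [boundaryVerts, List.nodup_cons] at h
  exact (List.nodup_append.1 h.2).1.of_map _

/-- `β` has no repeated vertex (the boundary polygon is simple). [folklore] -/
theorem nodup_β : D.β.Nodup := by
  have h := D.simple.nodup
  rw [boundaryVerts, List.nodup_cons] at h
  have h2 := (List.nodup_append.1 h.2).2.1
  rw [List.nodup_cons, List.nodup_reverse] at h2
  exact h2.2.of_map _

/-! ### (X1): no edge of `α` crosses an edge of `β` -/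

/-- The common midpoint of a dual pair of edges. [folklore] -/
theorem midpoint_eq_of_isDualPair {u u' w w' : ℤ × ℤ} (h : IsDualPair u u' w w') :
    AffineMap.lineMap (primalPt u) (primalPt u') (1 / 2 : ℝ) =
      AffineMap.lineMap (dualPt w') (dualPt w) (1 / 2 : ℝ) := by
  obtain ⟨-, -, h1, h2⟩ := h
  have h1' : (u.1 : ℝ) + u'.1 = w.1 + w'.1 + 1 := by exact_mod_cast h1
  have h2' : (u.2 : ℝ) + u'.2 = w.2 + w'.2 + 1 := by exact_mod_cast h2
  apply Complex.ext
  · simp only [AffineMap.lineMap_apply_module', sub_re, add_re, smul_re, primalPt_re, dualPt_re,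
      smul_eq_mul]
    linarith
  · simp only [AffineMap.lineMap_apply_module', sub_im, add_im, smul_im, primalPt_im, dualPt_im,
      smul_eq_mul]
    linarith

/-- **(X1) No edge of `α` is dual to an edge of `β`.** The common midpoint would lie on the
half-open polygon edge through the `α`-edge (index `1 + i`) and on the one through the `β`-edge
(index `|α| + |β| - j`, traversed backwards), two distinct edges of the simple boundary polygon.
[cite: LawlerSchrammWerner2004, §4.1] -/
theorem not_isDualPair {e f : (ℤ × ℤ) × (ℤ × ℤ)} (he : e ∈ D.α.zip D.α.tail)
    (hf : f ∈ D.β.zip D.β.tail) : ¬ IsDualPair e.1 e.2 f.1 f.2 := by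
  intro hd
  -- indices of the two edges
  obtain ⟨i, hi, rfl⟩ := List.getElem_of_mem he
  obtain ⟨j, hj, rfl⟩ := List.getElem_of_mem hf
  simp only [List.length_zip, List.length_tail] at hi hj
  have hi' : i + 1 < D.α.length := by omega
  have hj' : j + 1 < D.β.length := by omega
  have hN : (boundaryVerts D.α D.β D.a D.b).length = D.α.length + D.β.length + 2 :=
    length_boundaryVerts _ _ _ _
  -- the `α`-edge is the polygon edge `i + 1`, the `β`-edge the polygon edge `|α| + |β| - j`
  have hA1 := boundaryVerts_getElem_succ (β := D.β) D.a D.b (hi'.le.trans_lt' (Nat.lt_succ_self i))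
  have hA2 : (boundaryVerts D.α D.β D.a D.b)[(i + 1 + 1) % (boundaryVerts D.α D.β D.a D.b).length]'
      (Nat.mod_lt _ (by omega)) = primalPt D.α[i + 1] := by
    rw [getElem_congr_idx (Nat.mod_eq_of_lt (by omega))]
    exact boundaryVerts_getElem_succ D.a D.b hi'
  have hB1 : (boundaryVerts D.α D.β D.a D.b)[D.α.length + D.β.length - j]'(by omega) =
      dualPt D.β[j + 1] := by
    rw [getElem_congr_idx (show D.α.length + D.β.length - j = D.α.length + D.β.length + 1 - (j + 1) by
      omega)]
    exact boundaryVerts_getElem_β D.a D.b hj'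
  have hB2 : (boundaryVerts D.α D.β D.a D.b)[(D.α.length + D.β.length - j + 1) %
      (boundaryVerts D.α D.β D.a D.b).length]'(Nat.mod_lt _ (by omega)) = dualPt D.β[j] := by
    rw [getElem_congr_idx (show (D.α.length + D.β.length - j + 1) %
      (boundaryVerts D.α D.β D.a D.b).length = D.α.length + D.β.length + 1 - j by
        rw [Nat.mod_eq_of_lt (by omega)]; omega)]
    exact boundaryVerts_getElem_β D.a D.b (hj'.le.trans_lt' (Nat.lt_succ_self j))
  -- the common midpoint lies on both half-open edges
  have hdis := D.simple.disjoint (i + 1) (D.α.length + D.β.length - j) (by omega) (by omega)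
    (by omega)
  rw [hA1, hA2, hB1, hB2] at hdis
  refine Set.disjoint_left.1 hdis (lineMap_mem_icoSegment (θ := 1 / 2) ⟨by norm_num, by norm_num⟩) ?_
  simp only [List.getElem_zip, List.getElem_tail] at hd
  rw [midpoint_eq_of_isDualPair hd]
  exact lineMap_mem_icoSegment ⟨by norm_num, by norm_num⟩

/-! ### The frontier: walls and junctions -/

/-- The four **junction segments** `[a, α_a]`, `[a, β_a]`, `[b, α_b]`, `[b, β_b]` of the boundary
polygon. [cite: LawlerSchrammWerner2004, §4.1] -/
def junctions : Set ℂ :=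
  (segment ℝ (peanoPt D.a) (primalPt (primalNbr D.a)) ∪ segment ℝ (peanoPt D.a) (dualPt (dualNbr D.a))) ∪
    (segment ℝ (peanoPt D.b) (primalPt (primalNbr D.b)) ∪ segment ℝ (peanoPt D.b) (dualPt (dualNbr D.b)))

/-- **The frontier of `D` consists of the walls and the junctions**: `∂D ⊆ α ∪ β ∪ junctions`.
[cite: LawlerSchrammWerner2004, §4.1] -/
theorem frontier_subset_latticeBoundary_union :
    frontier D.carrier ⊆ D.latticeBoundary ∪ D.junctions := by
  rw [D.frontier_carrier, range_polygonLoop (by simp [boundaryVerts])]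
  refine iUnion_subset fun k ↦ ?_
  refine boundaryVerts_cyclic' (R := fun x y ↦ segment ℝ x y ⊆ D.latticeBoundary ∪ D.junctions)
    D.α_ne_nil D.β_ne_nil ?_ ?_ ?_ ?_ ?_ ?_ k k.2
  · rw [D.head_α]
    exact fun z hz ↦ Or.inr (Or.inl (Or.inl hz))
  · refine isChain_of_forall_zip_tail fun e he z hz ↦ Or.inl (Or.inl (Or.inr ?_))
    exact mem_iUnion₂.2 ⟨e, he, hz⟩
  · rw [D.getLast_α, segment_symm]
    exact fun z hz ↦ Or.inr (Or.inr (Or.inl hz))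
  · rw [D.getLast_β]
    exact fun z hz ↦ Or.inr (Or.inr (Or.inr hz))
  · refine isChain_of_forall_zip_tail fun e he z hz ↦ Or.inl (Or.inr (Or.inr ?_))
    rw [segment_symm] at hz
    exact mem_iUnion₂.2 ⟨e, he, hz⟩
  · rw [D.head_β, segment_symm]
    exact fun z hz ↦ Or.inr (Or.inl (Or.inr hz))

/-! ### Near `a` the frontier is the segment `[α_a, β_a]` -/

/-- No integer is within `¼` of a coordinate of a Peano vertex. [folklore] -/
theorem quarter_le_abs_int_sub (k c : ℤ) : 1 / 4 ≤ |(k : ℝ) - (c / 2 + 1 / 4)| := by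
  rcases Int.even_or_odd' c with ⟨t, rfl | rfl⟩ <;> push_cast
  · rcases le_or_gt k t with h | h
    · have h' : (k : ℝ) ≤ t := by exact_mod_cast h
      rw [abs_of_nonpos (by linarith)]; linarith
    · have h' : (t : ℝ) + 1 ≤ k := by exact_mod_cast h
      rw [abs_of_nonneg (by linarith)]; linarith
  · rcases le_or_gt k t with h | h
    · have h' : (k : ℝ) ≤ t := by exact_mod_cast h
      rw [abs_of_nonpos (by linarith)]; linarith
    · have h' : (t : ℝ) + 1 ≤ k := by exact_mod_cast h
      rw [abs_of_nonneg (by linarith)]; linarith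

/-- No half-integer is within `¼` of a coordinate of a Peano vertex. [folklore] -/
theorem quarter_le_abs_half_sub (k c : ℤ) : 1 / 4 ≤ |(k : ℝ) + 1 / 2 - (c / 2 + 1 / 4)| := by
  have := quarter_le_abs_int_sub (k + 1) (c + 1)
  push_cast at this
  rw [show (k : ℝ) + 1 - ((c + 1) / 2 + 1 / 4) = k + 1 / 2 - (c / 2 + 1 / 4) by ring] at this
  exact this

/-- **The walls stay at distance `≥ ¼` from every Peano vertex.** [folklore] -/
theorem quarter_le_dist_of_mem_latticeBoundary {z : ℂ} (hz : z ∈ D.latticeBoundary) (p : ℤ × ℤ) :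
    1 / 4 ≤ dist z (peanoPt p) := by
  rw [Complex.dist_eq]
  -- a point of the walls has an integer or a half-integer coordinate
  have key : (∃ k : ℤ, z.re = k ∨ z.im = k) ∨ ∃ k : ℤ, z.re = k + 1 / 2 ∨ z.im = k + 1 / 2 := by
    rcases hz with (⟨v, -, rfl⟩ | hz) | (⟨v, -, rfl⟩ | hz)
    · exact Or.inl ⟨v.1, Or.inl rfl⟩
    · obtain ⟨e, he, hz⟩ := mem_iUnion₂.1 hz
      rcases exists_int_of_mem_primalEdge (forall_zip_tail_of_isChain D.isChain_α e he) hz with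
        ⟨k, hk⟩ | ⟨k, hk⟩
      · exact Or.inl ⟨k, Or.inl hk⟩
      · exact Or.inl ⟨k, Or.inr hk⟩
    · exact Or.inr ⟨v.1, Or.inl rfl⟩
    · obtain ⟨e, he, hz⟩ := mem_iUnion₂.1 hz
      have hz' := swapC_mem_segment hz
      rw [swapC_dualPt, swapC_dualPt] at hz'
      rcases exists_int_of_mem_primalEdge ((latticeAdj_swapIdx _ _).2
        (forall_zip_tail_of_isChain D.isChain_β e he)) hz' with ⟨k, hk⟩ | ⟨k, hk⟩
      · refine Or.inr ⟨-k, Or.inr ?_⟩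
        rw [swapC_re] at hk
        push_cast; linarith
      · refine Or.inr ⟨-k, Or.inl ?_⟩
        rw [swapC_im] at hk
        push_cast; linarith
  rcases key with ⟨k, hk | hk⟩ | ⟨k, hk | hk⟩
  · refine (quarter_le_abs_int_sub k p.1).trans ?_
    rw [← hk, ← peanoPt_re, ← sub_re]
    exact Complex.abs_re_le_norm _
  · refine (quarter_le_abs_int_sub k p.2).trans ?_
    rw [← hk, ← peanoPt_im, ← sub_im]
    exact Complex.abs_im_le_norm _
  · refine (quarter_le_abs_half_sub k p.1).trans ?_
    rw [← hk, ← peanoPt_re, ← sub_re]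
    exact Complex.abs_re_le_norm _
  · refine (quarter_le_abs_half_sub k p.2).trans ?_
    rw [← hk, ← peanoPt_im, ← sub_im]
    exact Complex.abs_im_le_norm _

/-- The junctions at `b` stay at distance `≥ ¼` from `a` (a segment of `‖·‖_∞`-length `¼` from a
Peano vertex other than `a`). [folklore] -/
theorem quarter_le_dist_of_mem_diag {x : ℤ × ℤ} {v z : ℂ} (hx : x ≠ D.a)
    (hv : |(peanoPt x - v).re| = 1 / 4 ∧ |(peanoPt x - v).im| = 1 / 4)
    (hz : z ∈ segment ℝ (peanoPt x) v) : 1 / 4 ≤ dist z (peanoPt D.a) := by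
  obtain ⟨b, hb0, hb1, hre, him⟩ := coords_of_mem_segment hz
  rw [Complex.dist_eq]
  have hdr : |z.re - (peanoPt x).re| ≤ 1 / 4 := by
    rw [hre, add_sub_cancel_left, abs_mul, abs_of_nonneg hb0, abs_sub_comm, ← sub_re, hv.1]
    linarith
  have hdi : |z.im - (peanoPt x).im| ≤ 1 / 4 := by
    rw [him, add_sub_cancel_left, abs_mul, abs_of_nonneg hb0, abs_sub_comm, ← sub_im, hv.2]
    linarith
  -- `x ≠ a`: the two Peano vertices differ by `≥ ½` in some coordinate
  by_cases h1 : x.1 = D.a.1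
  · have h2 : x.2 ≠ D.a.2 := fun h2 ↦ hx (Prod.ext h1 h2)
    have hfar : 1 / 2 ≤ |(peanoPt x).im - (peanoPt D.a).im| := by
      rw [peanoPt_im, peanoPt_im, show (x.2 : ℝ) / 2 + 1 / 4 - (D.a.2 / 2 + 1 / 4) = (x.2 - D.a.2) / 2
        by ring, abs_div, abs_two]
      have : (1 : ℝ) ≤ |(x.2 : ℝ) - D.a.2| := by
        rw [← Int.cast_sub, ← Int.cast_abs]
        exact_mod_cast Int.one_le_abs (sub_ne_zero.2 h2)
      linarith
    calc (1 : ℝ) / 4 ≤ |(z - peanoPt D.a).im| := by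
          rw [sub_im]
          have := abs_sub_abs_le_abs_sub ((peanoPt x).im - (peanoPt D.a).im) ((peanoPt x).im - z.im)
          rw [show (peanoPt x).im - (peanoPt D.a).im - ((peanoPt x).im - z.im) =
            z.im - (peanoPt D.a).im by ring, abs_sub_comm ((peanoPt x).im) z.im] at this
          linarith
      _ ≤ ‖z - peanoPt D.a‖ := Complex.abs_im_le_norm _
  · have hfar : 1 / 2 ≤ |(peanoPt x).re - (peanoPt D.a).re| := by
      rw [peanoPt_re, peanoPt_re, show (x.1 : ℝ) / 2 + 1 / 4 - (D.a.1 / 2 + 1 / 4) = (x.1 - D.a.1) / 2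
        by ring, abs_div, abs_two]
      have : (1 : ℝ) ≤ |(x.1 : ℝ) - D.a.1| := by
        rw [← Int.cast_sub, ← Int.cast_abs]
        exact_mod_cast Int.one_le_abs (sub_ne_zero.2 h1)
      linarith
    calc (1 : ℝ) / 4 ≤ |(z - peanoPt D.a).re| := by
          rw [sub_re]
          have := abs_sub_abs_le_abs_sub ((peanoPt x).re - (peanoPt D.a).re) ((peanoPt x).re - z.re)
          rw [show (peanoPt x).re - (peanoPt D.a).re - ((peanoPt x).re - z.re) =
            z.re - (peanoPt D.a).re by ring, abs_sub_comm ((peanoPt x).re) z.re] at this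
          linarith
      _ ≤ ‖z - peanoPt D.a‖ := Complex.abs_re_le_norm _

/-- The primal and the dual neighbour are at `‖·‖_∞`-distance `¼`. [folklore] -/
theorem abs_sub_nbr (x : ℤ × ℤ) :
    (|(peanoPt x - primalPt (primalNbr x)).re| = 1 / 4 ∧ |(peanoPt x - primalPt (primalNbr x)).im| = 1 / 4) ∧
      (|(peanoPt x - dualPt (dualNbr x)).re| = 1 / 4 ∧ |(peanoPt x - dualPt (dualNbr x)).im| = 1 / 4) :=
  ⟨abs_re_peanoPt_sub_primalPt x, abs_re_peanoPt_sub_dualPt x⟩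

/-- `a` is the midpoint of `[α_a, β_a]`, as a point of the segment. [folklore] -/
theorem peanoPt_a_mem_segment :
    peanoPt D.a ∈ segment ℝ (primalPt (primalNbr D.a)) (dualPt (dualNbr D.a)) := by
  have h := peanoPt_eq_midpoint D.a
  refine mem_segment_of_eq (b := 1 / 2) (by norm_num) (by norm_num) ?_ ?_
  · rw [h]; simp; ring
  · rw [h]; simp; ring

/-- **Near `a` the frontier is straight**: a frontier point within distance `¼` of `a` lies on the
segment `[α_a, β_a]`. [cite: LawlerSchrammWerner2004, §4.1] -/
theorem mem_segment_of_mem_frontier {z : ℂ} (hz : z ∈ frontier D.carrier)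
    (hd : dist z (peanoPt D.a) < 1 / 4) :
    z ∈ segment ℝ (primalPt (primalNbr D.a)) (dualPt (dualNbr D.a)) := by
  have hconv : Convex ℝ (segment ℝ (primalPt (primalNbr D.a)) (dualPt (dualNbr D.a))) :=
    convex_segment _ _
  rcases D.frontier_subset_latticeBoundary_union hz with hz | ((hz | hz) | (hz | hz))
  · exact absurd hd (not_lt.2 (D.quarter_le_dist_of_mem_latticeBoundary hz D.a))
  · exact hconv.segment_subset D.peanoPt_a_mem_segment (left_mem_segment _ _ _) hz
  · exact hconv.segment_subset D.peanoPt_a_mem_segment (right_mem_segment _ _ _) hz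
  · exact absurd hd (not_lt.2 (D.quarter_le_dist_of_mem_diag D.a_ne_b.symm (abs_sub_nbr D.b).1 hz))
  · exact absurd hd (not_lt.2 (D.quarter_le_dist_of_mem_diag D.a_ne_b.symm (abs_sub_nbr D.b).2 hz))

/-! ### The two sides of `[α_a, β_a]` at `a` -/

/-- The direction `d = β_a - α_a` of the segment through `a`. [folklore] -/
def dirA : ℂ := dualPt (dualNbr D.a) - primalPt (primalNbr D.a)

/-- **The side functional at `a`**: `cross d (z - a)`, negative to the right of the oriented
segment `[α_a, β_a]`, positive to its left, zero on it. [folklore] -/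
def side (z : ℂ) : ℝ := cross D.dirA (z - peanoPt D.a)

/-- `a = α_a + d/2`. [folklore] -/
theorem peanoPt_a_re_im : (peanoPt D.a).re = (primalPt (primalNbr D.a)).re + D.dirA.re / 2 ∧
    (peanoPt D.a).im = (primalPt (primalNbr D.a)).im + D.dirA.im / 2 := by
  have h := peanoPt_eq_midpoint D.a
  constructor
  · rw [h, dirA]; simp; ring
  · rw [h, dirA]; simp; ring

/-- `|d.re| = |d.im| = ½`. [folklore] -/
theorem abs_dirA : |D.dirA.re| = 1 / 2 ∧ |D.dirA.im| = 1 / 2 := by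
  obtain ⟨h1, h2⟩ := D.peanoPt_a_re_im
  obtain ⟨h3, h4⟩ := abs_re_peanoPt_sub_primalPt D.a
  rw [sub_re] at h3
  rw [sub_im] at h4
  constructor
  · rw [show D.dirA.re = 2 * ((peanoPt D.a).re - (primalPt (primalNbr D.a)).re) by linarith,
      abs_mul, h3]
    norm_num
  · rw [show D.dirA.im = 2 * ((peanoPt D.a).im - (primalPt (primalNbr D.a)).im) by linarith,
      abs_mul, h4]
    norm_num

/-- `d.re² = d.im² = ¼`. [folklore] -/
theorem sq_dirA : D.dirA.re ^ 2 = 1 / 4 ∧ D.dirA.im ^ 2 = 1 / 4 := by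
  obtain ⟨h1, h2⟩ := D.abs_dirA
  constructor
  · rw [← sq_abs, h1]; norm_num
  · rw [← sq_abs, h2]; norm_num

/-- The side functional vanishes on the segment `[α_a, β_a]`. [folklore] -/
theorem side_eq_zero_of_mem_segment {z : ℂ}
    (hz : z ∈ segment ℝ (primalPt (primalNbr D.a)) (dualPt (dualNbr D.a))) : D.side z = 0 := by
  obtain ⟨b, -, -, hre, him⟩ := coords_of_mem_segment hz
  obtain ⟨h1, h2⟩ := D.peanoPt_a_re_im
  have e1 : (z - peanoPt D.a).re = (b - 1 / 2) * D.dirA.re := by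
    rw [sub_re, hre, h1, dirA, sub_re]; ring
  have e2 : (z - peanoPt D.a).im = (b - 1 / 2) * D.dirA.im := by
    rw [sub_im, him, h2, dirA, sub_im]; ring
  rw [side, cross, e1, e2]; ring

/-- **A point near `a` with vanishing side functional lies on `[α_a, β_a]`.** [folklore] -/
theorem mem_segment_of_side_eq_zero {y : ℂ} (hy : dist y (peanoPt D.a) < 1 / 4) (h0 : D.side y = 0) :
    y ∈ segment ℝ (primalPt (primalNbr D.a)) (dualPt (dualNbr D.a)) := by
  obtain ⟨h1, h2⟩ := D.peanoPt_a_re_im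
  obtain ⟨ha1, ha2⟩ := D.abs_dirA
  obtain ⟨hre2, him2⟩ := D.sq_dirA
  set v := y - peanoPt D.a with hv
  have hcross : D.dirA.re * v.im - D.dirA.im * v.re = 0 := h0
  -- `v = t d`
  set t := 2 * (v.re * D.dirA.re + v.im * D.dirA.im) with ht
  have hvre : v.re = t * D.dirA.re := by
    rw [ht]
    linear_combination (-2 * D.dirA.im) * hcross + (-2 * v.re) * hre2 + (-2 * v.re) * him2
  have hvim : v.im = t * D.dirA.im := by
    rw [ht]
    linear_combination (2 * D.dirA.re) * hcross + (-2 * v.im) * hre2 + (-2 * v.im) * him2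
  -- `|t| < ½`
  have hvn : ‖v‖ < 1 / 4 := by rwa [hv, ← Complex.dist_eq]
  have htabs : |t| ≤ 1 / 2 := by
    have hr := Complex.abs_re_le_norm v
    have hi := Complex.abs_im_le_norm v
    rw [ht, abs_mul, abs_two]
    have := abs_add_le (v.re * D.dirA.re) (v.im * D.dirA.im)
    rw [abs_mul, abs_mul, ha1, ha2] at this
    linarith
  refine mem_segment_of_eq (b := 1 / 2 + t) (by linarith [neg_abs_le t]) (by linarith [le_abs_self t])
    ?_ ?_
  · have : y.re = (peanoPt D.a).re + v.re := by rw [hv, sub_re]; ring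
    rw [this, h1, hvre, dirA, sub_re]; ring
  · have : y.im = (peanoPt D.a).im + v.im := by rw [hv, sub_im]; ring
    rw [this, h2, hvim, dirA, sub_im]; ring

/-- The side functional is affine: `{side < 0}` and `{side > 0}` are convex. [folklore] -/
theorem isLinearMap_cross_dirA : IsLinearMap ℝ fun z : ℂ ↦ cross D.dirA z :=
  ⟨fun x y ↦ by simp only [cross, add_re, add_im]; ring,
    fun c x ↦ by simp only [cross, smul_re, smul_im, smul_eq_mul]; ring⟩

/-- The open right half-disc `H⁺` at `a` is convex. [folklore] -/
theorem convex_halfDisc_neg : Convex ℝ (ball (peanoPt D.a) (1 / 4) ∩ {z | D.side z < 0}) := by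
  have : {z | D.side z < 0} = {z | cross D.dirA z < cross D.dirA (peanoPt D.a)} := by
    ext z
    simp only [mem_setOf_eq, side, cross, sub_re, sub_im]
    constructor <;> intro h <;> linarith
  rw [this]
  exact (convex_ball _ _).inter (convex_halfSpace_lt D.isLinearMap_cross_dirA _)

/-- The open left half-disc `H⁻` at `a` is convex. [folklore] -/
theorem convex_halfDisc_pos : Convex ℝ (ball (peanoPt D.a) (1 / 4) ∩ {z | 0 < D.side z}) := by
  have : {z | 0 < D.side z} = {z | cross D.dirA (peanoPt D.a) < cross D.dirA z} := by
    ext z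
    simp only [mem_setOf_eq, side, cross, sub_re, sub_im]
    constructor <;> intro h <;> linarith
  rw [this]
  exact (convex_ball _ _).inter (convex_halfSpace_gt D.isLinearMap_cross_dirA _)

/-- A half-disc at `a` misses the frontier. [folklore] -/
theorem disjoint_halfDisc_frontier {s : Set ℂ} (hs : s ⊆ {z | D.side z ≠ 0}) :
    Disjoint (ball (peanoPt D.a) (1 / 4) ∩ s) (frontier D.carrier) := by
  refine Set.disjoint_left.2 fun z ⟨hzb, hzs⟩ hzf ↦ hs hzs ?_
  exact D.side_eq_zero_of_mem_segment (D.mem_segment_of_mem_frontier hzf (mem_ball.1 hzb))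

/-- **The test point lies in `H⁺`.** `rightTestPt a = a + ¼ (-i d)` is at distance `‖d‖/4 < ¼`
from `a` and has side functional `-‖d‖²/4 < 0`. [cite: LawlerSchrammWerner2004, §4.1] -/
theorem rightTestPt_mem_halfDisc :
    rightTestPt D.a ∈ ball (peanoPt D.a) (1 / 4) ∩ {z | D.side z < 0} := by
  obtain ⟨hre2, him2⟩ := D.sq_dirA
  have hw : rightTestPt D.a - peanoPt D.a = (1 / 4 : ℂ) * (-I * D.dirA) := by
    rw [rightTestPt, dirA]; ring
  have hwre : (rightTestPt D.a - peanoPt D.a).re = D.dirA.im / 4 := by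
    rw [hw]; simp; ring
  have hwim : (rightTestPt D.a - peanoPt D.a).im = -D.dirA.re / 4 := by
    rw [hw]; simp; ring
  constructor
  · rw [mem_ball, Complex.dist_eq]
    refine lt_of_pow_lt_pow_left₀ 2 (by norm_num) ?_
    rw [Complex.sq_norm, Complex.normSq_apply, hwre, hwim]
    nlinarith
  · show cross D.dirA (rightTestPt D.a - peanoPt D.a) < 0
    rw [cross, hwre, hwim]
    nlinarith

/-- **The right half-disc lies in `D`.** [cite: LawlerSchrammWerner2004, §4.1] -/
theorem halfDisc_neg_subset : ball (peanoPt D.a) (1 / 4) ∩ {z | D.side z < 0} ⊆ D.carrier :=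
  D.subset_carrier_of_isPreconnected D.convex_halfDisc_neg.isPreconnected
    (D.disjoint_halfDisc_frontier fun _ hz ↦ ne_of_lt hz) D.rightTestPt_mem_halfDisc
    D.rightTestPt_mem

/-- **The left half-disc misses `D`**: otherwise, both half-discs lying in `D` and the diameter
on the frontier, no exterior point would come close to the frontier point `a`.
[cite: LawlerSchrammWerner2004, §4.1] -/
theorem halfDisc_pos_disjoint :
    Disjoint (ball (peanoPt D.a) (1 / 4) ∩ {z | 0 < D.side z}) D.carrier := by
  rw [Set.disjoint_left]
  intro w hw hwD
  have hsub : ball (peanoPt D.a) (1 / 4) ∩ {z | 0 < D.side z} ⊆ D.carrier :=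
    D.subset_carrier_of_isPreconnected D.convex_halfDisc_pos.isPreconnected
      (D.disjoint_halfDisc_frontier fun _ hz ↦ (ne_of_lt hz).symm) hw hwD
  -- an exterior point close to `a`
  have ha : peanoPt D.a ∈ closure (closure D.carrier)ᶜ :=
    D.toJordanDomain.frontier_subset_closure_exterior
      Literature.Topology.PlaneTopology.JordanCurveTheorem_holds D.peanoPt_a_mem_frontier
  obtain ⟨y, hy, hd⟩ := Metric.mem_closure_iff.1 ha (1 / 4) (by norm_num)
  rw [dist_comm] at hd
  have hyD : y ∉ D.carrier := fun h ↦ hy (subset_closure h)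
  have hyf : y ∉ frontier D.carrier := fun h ↦ hy (frontier_subset_closure h)
  rcases lt_trichotomy (D.side y) 0 with h0 | h0 | h0
  · exact hyD (D.halfDisc_neg_subset ⟨mem_ball.2 hd, h0⟩)
  · refine hyf ?_
    rw [D.frontier_carrier]
    -- the segment `[α_a, β_a]` lies on the polygon: edges `0` and `N - 1`
    have hseg := D.mem_segment_of_side_eq_zero hd h0
    obtain ⟨b, hb0, hb1, hre, him⟩ := coords_of_mem_segment hseg
    have hl : boundaryVerts D.α D.β D.a D.b ≠ [] := by simp [boundaryVerts]
    have hN : (boundaryVerts D.α D.β D.a D.b).length = D.α.length + D.β.length + 2 :=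
      length_boundaryVerts _ _ _ _
    have h0N : 0 < (boundaryVerts D.α D.β D.a D.b).length := by omega
    obtain ⟨h1, h2⟩ := D.peanoPt_a_re_im
    rw [range_polygonLoop hl, mem_iUnion]
    rcases le_or_gt b (1 / 2) with hb | hb
    · -- on the edge `[a, α_a]` (polygon edge `0`, backwards)
      refine ⟨⟨0, h0N⟩, ?_⟩
      have e0 : (boundaryVerts D.α D.β D.a D.b)[(0 : ℕ)] = peanoPt D.a := boundaryVerts_zero _ _ _ _
      have e1 : (boundaryVerts D.α D.β D.a D.b)[(0 + 1) % (boundaryVerts D.α D.β D.a D.b).length]'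
          (Nat.mod_lt _ h0N) = primalPt (primalNbr D.a) := by
        rw [getElem_congr_idx (show (0 + 1) % (boundaryVerts D.α D.β D.a D.b).length = 1 by
          rw [Nat.mod_eq_of_lt (by omega)]), boundaryVerts_one _ _ D.α_ne_nil, D.head_α]
      rw [e0, e1]
      refine mem_segment_of_eq (b := 1 - 2 * b) (by linarith) (by linarith) ?_ ?_
      · rw [hre, h1, dirA, sub_re]; ring
      · rw [him, h2, dirA, sub_im]; ring
    · -- on the edge `[β_a, a]` (polygon edge `N - 1`)
      refine ⟨⟨(boundaryVerts D.α D.β D.a D.b).length - 1, by omega⟩, ?_⟩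
      have e0 : (boundaryVerts D.α D.β D.a D.b)[(boundaryVerts D.α D.β D.a D.b).length - 1] =
          dualPt (dualNbr D.a) := by rw [boundaryVerts_length_sub_one _ _ D.β_ne_nil, D.head_β]
      have e1 : (boundaryVerts D.α D.β D.a D.b)[((boundaryVerts D.α D.β D.a D.b).length - 1 + 1) %
          (boundaryVerts D.α D.β D.a D.b).length]'(Nat.mod_lt _ h0N) = peanoPt D.a := by
        rw [getElem_congr_idx (show ((boundaryVerts D.α D.β D.a D.b).length - 1 + 1) %
          (boundaryVerts D.α D.β D.a D.b).length = 0 by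
            rw [Nat.sub_add_cancel (by omega), Nat.mod_self]), boundaryVerts_zero]
      rw [e0, e1]
      refine mem_segment_of_eq (b := 2 - 2 * b) (by linarith) (by linarith) ?_ ?_
      · rw [hre, h1, dirA, sub_re]; ring
      · rw [him, h2, dirA, sub_im]; ring
  · exact hyD (hsub ⟨mem_ball.2 hd, h0⟩)

/-! ### The Manhattan edges at `a`: leaving to the right, entering from the left -/

/-- The two edges leaving `a` point into `H⁺`: `cross d (stepD a - a) = cross d (stepP a - a) = -¼`.
[cite: LawlerSchrammWerner2004, §4.1] -/
theorem cross_dir_step (a : ℤ × ℤ) :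
    cross (dualPt (dualNbr a) - primalPt (primalNbr a)) (peanoPt (stepD a) - peanoPt a) = -(1 / 4) ∧
      cross (dualPt (dualNbr a) - primalPt (primalNbr a)) (peanoPt (stepP a) - peanoPt a) = -(1 / 4) := by
  obtain ⟨m, n, rfl | rfl | rfl | rfl⟩ := parity_cases a <;>
    simp only [cross, sub_re, sub_im, stepD_ee, stepD_eo, stepD_oe, stepD_oo, stepP_ee, stepP_eo,
      stepP_oe, stepP_oo, dualNbr_ee, dualNbr_eo, dualNbr_oe, dualNbr_oo, primalNbr_ee, primalNbr_eo,
      primalNbr_oe, primalNbr_oo, peanoPt_re_even, peanoPt_re_odd, peanoPt_im_even, peanoPt_im_odd,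
      dualPt_re, dualPt_im, primalPt_re, primalPt_im, Int.cast_add, Int.cast_sub, Int.cast_one] <;>
    constructor <;> ring

/-- The two edges entering `a` come from `H⁻`: `cross d (r - a) = ¼` for every in-neighbour `r`
of `a` (the in-neighbours are `stepD³ a` and its co-source). [cite: LawlerSchrammWerner2004, §4.1] -/
theorem cross_dir_of_manhattan_to {r a : ℤ × ℤ} (h : Manhattan r a) :
    cross (dualPt (dualNbr a) - primalPt (primalNbr a)) (peanoPt r - peanoPt a) = 1 / 4 := by
  rw [← stepD_stepD_stepD_stepD a, manhattan_to_stepD_iff] at h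
  rw [← stepD_stepD_stepD_stepD a]
  obtain ⟨m, n, rfl | rfl | rfl | rfl⟩ := parity_cases a <;> rcases h with rfl | rfl <;>
    simp only [cross, sub_re, sub_im, stepD_ee, stepD_eo, stepD_oe, stepD_oo, coSrc_ee, coSrc_eo,
      coSrc_oe, coSrc_oo, dualNbr_ee, dualNbr_eo, dualNbr_oe, dualNbr_oo, primalNbr_ee, primalNbr_eo,
      primalNbr_oe, primalNbr_oo, peanoPt_re_even, peanoPt_re_odd, peanoPt_im_even, peanoPt_im_odd,
      dualPt_re, dualPt_im, primalPt_re, primalPt_im, Int.cast_add, Int.cast_sub, Int.cast_one] <;>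
    ring

/-! ### (X2): unblocked edges stay in `D` -/

/-- A point `x + θ (y - x)`, `θ ∈ [0, 1]`, of a segment. [folklore] -/
theorem add_smul_mem_segment (x y : ℂ) {θ : ℝ} (h0 : 0 ≤ θ) (h1 : θ ≤ 1) :
    x + θ • (y - x) ∈ segment ℝ x y :=
  mem_segment_of_eq h0 h1 (by simp) (by simp)

/-- A Manhattan edge `[p, q]` which does not cross a wall meets the frontier only in `a` or `b`,
and only if that vertex is `p` or `q`. [folklore] -/
theorem eq_of_mem_frontier_of_mem_segment {p q : ℤ × ℤ} (hm : Manhattan p q)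
    (hP : ∀ e ∈ D.α.zip D.α.tail, ¬ (q = stepP p ∧ s(e.1, e.2) = s(primalNbr p, farP p)))
    (hD : ∀ f ∈ D.β.zip D.β.tail, ¬ (q = stepD p ∧ s(f.1, f.2) = s(dualNbr p, farD p)))
    {z : ℂ} (hz : z ∈ segment ℝ (peanoPt p) (peanoPt q)) (hzf : z ∈ frontier D.carrier) :
    (z = peanoPt D.a ∧ (D.a = p ∨ D.a = q)) ∨ (z = peanoPt D.b ∧ (D.b = p ∨ D.b = q)) := by
  rcases D.frontier_subset_latticeBoundary_union hzf with (hz' | hz') | ((hz' | hz') | (hz' | hz'))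
  · exact absurd hz' (Set.disjoint_left.1 (disjoint_segment_primalPathSet D.isChain_α hm hP) hz)
  · exact absurd hz' (Set.disjoint_left.1 (disjoint_segment_dualPathSet D.isChain_β hm hD) hz)
  · exact Or.inl (eq_peanoPt_of_mem_diag hm (abs_sub_nbr D.a).1 hz hz')
  · exact Or.inl (eq_peanoPt_of_mem_diag hm (abs_sub_nbr D.a).2 hz hz')
  · exact Or.inr (eq_peanoPt_of_mem_diag hm (abs_sub_nbr D.b).1 hz hz')
  · exact Or.inr (eq_peanoPt_of_mem_diag hm (abs_sub_nbr D.b).2 hz hz')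

/-- **(X2) at `a`**: an unblocked Manhattan edge from `a` ends in `D` (or at `b`). The half-open
edge `(a, q]` misses the frontier, is connected, and starts in the right half-disc `H⁺ ⊆ D`.
[cite: LawlerSchrammWerner2004, §4.1] -/
theorem peanoPt_mem_carrier_of_step_a {q : ℤ × ℤ} (hm : Manhattan D.a q) (hqb : q ≠ D.b)
    (hP : ∀ e ∈ D.α.zip D.α.tail, ¬ (q = stepP D.a ∧ s(e.1, e.2) = s(primalNbr D.a, farP D.a)))
    (hD : ∀ f ∈ D.β.zip D.β.tail, ¬ (q = stepD D.a ∧ s(f.1, f.2) = s(dualNbr D.a, farD D.a))) :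
    peanoPt q ∈ D.carrier := by
  set pa := peanoPt D.a with hpa
  set pq := peanoPt q with hpq
  have hne : pq ≠ pa := fun h ↦ by
    have := peanoPt_injective h
    rw [this] at hm
    rcases (manhattan_iff_step _ _).1 hm with h1 | h1
    · exact stepD_ne_self _ h1.symm
    · exact stepP_ne_self _ h1.symm
  set S : Set ℂ := (fun θ : ℝ ↦ pa + θ • (pq - pa)) '' Ioc 0 1 with hS
  have hSpre : IsPreconnected S :=
    isPreconnected_Ioc.image _ (Continuous.continuousOn (by fun_prop))
  have hSf : Disjoint S (frontier D.carrier) := by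
    refine Set.disjoint_left.2 ?_
    rintro _ ⟨θ, ⟨hθ0, hθ1⟩, rfl⟩ hzf
    have hz : pa + θ • (pq - pa) ∈ segment ℝ pa pq := add_smul_mem_segment pa pq hθ0.le hθ1
    rcases D.eq_of_mem_frontier_of_mem_segment hm hP hD hz hzf with ⟨h1, -⟩ | ⟨-, h2 | h2⟩
    · have : θ • (pq - pa) = 0 := add_eq_left.1 (h1.trans hpa.symm)
      rcases smul_eq_zero.1 this with h | h
      · exact hθ0.ne' h
      · exact hne (sub_eq_zero.1 h)
    · exact D.a_ne_b h2.symm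
    · exact hqb h2.symm
  -- a point of `S` in the right half-disc
  have hz0S : pa + (1 / 4 : ℝ) • (pq - pa) ∈ S := ⟨1 / 4, ⟨by norm_num, by norm_num⟩, rfl⟩
  have hz0 : pa + (1 / 4 : ℝ) • (pq - pa) ∈ D.carrier := by
    refine D.halfDisc_neg_subset ⟨?_, ?_⟩
    · rw [mem_ball, dist_eq_norm, add_sub_cancel_left, norm_smul, Real.norm_of_nonneg (by norm_num),
        ← dist_eq_norm, hpq, hpa, dist_comm, dist_peanoPt_of_manhattan hm]
      norm_num
    · show cross D.dirA (pa + (1 / 4 : ℝ) • (pq - pa) - peanoPt D.a) < 0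
      rw [hpa, add_sub_cancel_left, (D.isLinearMap_cross_dirA).map_smul, smul_eq_mul]
      rcases (manhattan_iff_step _ _).1 hm with h1 | h1
      · rw [hpq, h1, dirA, (cross_dir_step D.a).1]; norm_num
      · rw [hpq, h1, dirA, (cross_dir_step D.a).2]; norm_num
  have hSD := D.subset_carrier_of_isPreconnected hSpre hSf hz0S hz0
  have : pq ∈ S := ⟨1, ⟨one_pos, le_rfl⟩, by simp⟩
  exact hSD this

/-- **(X2) inside**: an unblocked Manhattan edge from a Peano vertex of `D` ends in `D` (or at
`b`). It cannot end at `a` (it would arrive through the left half-disc `H⁻`, which misses `D`);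
otherwise the closed edge misses the frontier. [cite: LawlerSchrammWerner2004, §4.1] -/
theorem peanoPt_mem_carrier_of_step {p q : ℤ × ℤ} (hp : peanoPt p ∈ D.carrier)
    (hm : Manhattan p q) (hqb : q ≠ D.b)
    (hP : ∀ e ∈ D.α.zip D.α.tail, ¬ (q = stepP p ∧ s(e.1, e.2) = s(primalNbr p, farP p)))
    (hD : ∀ f ∈ D.β.zip D.β.tail, ¬ (q = stepD p ∧ s(f.1, f.2) = s(dualNbr p, farD p))) :
    peanoPt q ∈ D.carrier := by
  set pa := peanoPt D.a with hpa
  set pp := peanoPt p with hpp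
  set pq := peanoPt q with hpq
  have hpa' : p ≠ D.a := fun h ↦ D.peanoPt_a_notMem (h ▸ hp)
  have hpb : p ≠ D.b := fun h ↦ D.peanoPt_b_notMem (h ▸ hp)
  -- the edge does not end at `a`
  have hqa : q ≠ D.a := by
    intro hqa
    subst hqa
    set S : Set ℂ := (fun θ : ℝ ↦ pp + θ • (pa - pp)) '' Ico 0 1 with hS
    have hSpre : IsPreconnected S :=
      isPreconnected_Ico.image _ (Continuous.continuousOn (by fun_prop))
    have hSf : Disjoint S (frontier D.carrier) := by
      refine Set.disjoint_left.2 ?_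
      rintro _ ⟨θ, ⟨hθ0, hθ1⟩, rfl⟩ hzf
      have hz : pp + θ • (pa - pp) ∈ segment ℝ pp pa := add_smul_mem_segment pp pa hθ0 hθ1.le
      rcases D.eq_of_mem_frontier_of_mem_segment hm hP hD hz hzf with ⟨h1, -⟩ | ⟨-, h2 | h2⟩
      · have h1' : pp + θ • (pa - pp) = pa := h1.trans hpa.symm
        have : (1 - θ) • (pa - pp) = 0 :=
          calc (1 - θ) • (pa - pp) = pa - (pp + θ • (pa - pp)) := by rw [sub_smul, one_smul]; abel
            _ = 0 := by rw [h1', sub_self]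
        rcases smul_eq_zero.1 this with h | h
        · exact hθ1.ne' (by linarith)
        · exact hpa' (peanoPt_injective (sub_eq_zero.1 h).symm)
      · exact hpb h2.symm
      · exact D.a_ne_b h2.symm
    have hppS : pp ∈ S := ⟨0, ⟨le_rfl, one_pos⟩, by simp⟩
    have hSD := D.subset_carrier_of_isPreconnected hSpre hSf hppS hp
    -- the point at parameter `3/4` is in the left half-disc
    have hz1S : pp + (3 / 4 : ℝ) • (pa - pp) ∈ S := ⟨3 / 4, ⟨by norm_num, by norm_num⟩, rfl⟩
    have aux : pp + (3 / 4 : ℝ) • (pa - pp) - pa = (1 / 4 : ℝ) • (pp - pa) := by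
      simp only [Complex.real_smul]; push_cast; ring
    refine Set.disjoint_left.1 D.halfDisc_pos_disjoint ⟨?_, ?_⟩ (hSD hz1S)
    · rw [mem_ball, dist_eq_norm, aux, norm_smul, Real.norm_of_nonneg (by norm_num), ← dist_eq_norm,
        hpp, hpa, dist_peanoPt_of_manhattan hm]
      norm_num
    · show 0 < cross D.dirA (pp + (3 / 4 : ℝ) • (pa - pp) - peanoPt D.a)
      rw [← hpa, aux, (D.isLinearMap_cross_dirA).map_smul, smul_eq_mul, hpp, hpa, dirA,
        cross_dir_of_manhattan_to hm]
      norm_num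
  -- now the closed edge misses the frontier
  have hSf : Disjoint (segment ℝ pp pq) (frontier D.carrier) := by
    refine Set.disjoint_left.2 fun z hz hzf ↦ ?_
    rcases D.eq_of_mem_frontier_of_mem_segment hm hP hD hz hzf with ⟨-, h | h⟩ | ⟨-, h | h⟩
    · exact hpa' h.symm
    · exact hqa h.symm
    · exact hpb h.symm
    · exact hqb h.symm
  exact D.subset_carrier_of_isPreconnected (convex_segment _ _).isPreconnected hSf
    (left_mem_segment _ _ _) hp (right_mem_segment _ _ _)

/-! ### The peeling axioms -/

/-- An unblocked edge does not cross a wall (the two `∀`-forms used by the geometric lemmas).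
[folklore] -/
theorem forall_not_of_not_blocked {p q : ℤ × ℤ} (h : ¬ D.peelData.Blocked p q) :
    (∀ e ∈ D.α.zip D.α.tail, ¬ (q = stepP p ∧ s(e.1, e.2) = s(primalNbr p, farP p))) ∧
      ∀ f ∈ D.β.zip D.β.tail, ¬ (q = stepD p ∧ s(f.1, f.2) = s(dualNbr p, farD p)) := by
  refine ⟨fun e he ⟨hq, hee⟩ ↦ h (Or.inl ⟨hq, ?_⟩), fun f hf ⟨hq, hff⟩ ↦ h (Or.inr ⟨hq, ?_⟩)⟩
  · rw [← hee]; exact List.mem_map_of_mem he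
  · rw [← hff]; exact List.mem_map_of_mem hf

/-- **The peeling data of a domain `D ∈ 𝔇*` (with `α`, `β` simple) satisfies the axioms (X0)–(X2).**
[cite: LawlerSchrammWerner2004, §4.1] -/
theorem good_peelData : PeelData.Good D.peelData where
  α_ne := D.α_ne_nil
  β_ne := D.β_ne_nil
  chainα := D.isChain_α
  chainβ := D.isChain_β
  headα := D.head_α
  headβ := D.head_β
  lastα := D.getLast_α
  lastβ := D.getLast_β
  nodupα := D.nodup_α
  nodupβ := D.nodup_β
  a_ne_b := D.a_ne_b
  a_notMem := by simpa [mem_peelData_V] using D.peanoPt_a_notMem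
  b_notMem := by simpa [mem_peelData_V] using D.peanoPt_b_notMem
  nocross e he f hf := D.not_isDualPair he hf
  closed := by
    intro p hp q hm hbl
    by_cases hqb : q = D.b
    · exact Or.inl hqb
    refine Or.inr ((D.mem_peelData_V).2 ?_)
    obtain ⟨hP, hD⟩ := D.forall_not_of_not_blocked hbl
    rcases hp with rfl | hp
    · exact D.peanoPt_mem_carrier_of_step_a hm hqb hP hD
    · exact D.peanoPt_mem_carrier_of_step ((D.mem_peelData_V).1 hp) hm hqb hP hD

end Domain

end USTPeano

end Literature.Probability.RandomPlanarGeometry
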